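import Summits.ABC.ABC.Theorems.StewartYu1991TwoThirdsHolds
import Literature.Barriers.ABC.BakerMethodBoundsEpsShapeThreshold
import HarnessLib

/-!
# The `ε`-free corollary of the kernel's Stewart–Yu 1991 theorem: `log c ≤ κ · rad(abc)`

`Summits/ABC/ABC/Theorems/BakerShapeBoundOneZero.lean` — papers lane ABC-P1 (writer seat
`papers-abcp1-w1`), a corollary file next to the rung file `StewartYu1991TwoThirdsHolds.lean` of cell
`abc-stewartyu`; theorems only (no definition, no named fact).

`Summit.ABC.ABC.Theorems.stewartYu1991_holds : Literature.Barriers.ABC.stewartYu1991_upperBound`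
(`= EpsShapeBound (2/3)`: for every `ε > 0` there are `κ(ε), c₀(ε)` with `log c ≤ κ(ε) · rad^{2/3+ε}` for
every abc triple with `c ≥ c₀(ε)`) gives, at `ε = 1/3` and after absorbing the threshold
(`Literature.Barriers.ABC.bakerShapeBound_of_epsShapeBound`: `rad ≥ 1`, `log c ≤ log c₀` below `c₀`), the
`ε`-free, threshold-free shape `BakerShapeBound 1 0` — one constant `κ` with `log c ≤ κ · rad(abc)` for
EVERY abc triple (and, at `ε = 15 − 2/3`, the Stewart–Tijdeman 1986 leaf: `Literature.Barriers.ABC.stewartTijdeman1986_of_stewartYu1991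
stewartYu1991_holds` has the type of `stewartTijdeman1986_holds`, whose own proof goes through the odd-prime
socket with no archimedean input — not restated here).  Not progress on abc (`θ = 0` is abc's shape): the
bound is exponential in the radical.
-/

set_option linter.dupNamespace false

namespace Summit.ABC.ABC.Theorems

/-- **`log c ≤ κ · rad(abc)` for all abc triples** (`Literature.Barriers.ABC.BakerShapeBound 1 0`): the
`ε`-free corollary (`ε = 1/3`, threshold absorbed) of the kernel's Stewart–Yu 1991 theorem
`stewartYu1991_holds`. [cite: StewartYu1991, Theorem (p. 226), "in particular" clause, as quoted in
Waldschmidt2014 §2] -/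
theorem bakerShapeBound_one_zero : Literature.Barriers.ABC.BakerShapeBound 1 0 :=
  Literature.Barriers.ABC.bakerShapeBound_of_epsShapeBound (θ₀ := 2 / 3) (by norm_num) (by norm_num)
    (Literature.Barriers.ABC.stewartYu1991_iff_epsShapeBound.mp stewartYu1991_holds)

end Summit.ABC.ABC.Theorems
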